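import Mathlib
import HarnessLib
import Summits.ResolutionOfSingularities.ResolutionOfSingularities.Theorems.HomologicalConductorPersistenceCompletionAscentSyzygyRetract

/-!
# Lattices over a Frobenius order are infinite syzygies; hence «not stably annihilated ⇒ outside
# `caⁿ` for EVERY `n`» — the all-levels device of the K-C3 kill without Gorenstein theory

Route `ResolutionOfSingularities/HomologicalConductor`, chain W4.4b, crux `Persistence`
(stmt-ResolutionOfSingularities-16484), KILL CANDIDATE K-C3 (res-L1-w44b-plan-1 ASSIGN v1.9
2026-08-27T11:44:56Z: source `{xy = z³ + t⁴}`, arrival `T₁ = W_𝔪`, `W = k[a,b,c]^{μ₆(1,2,3)}`,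
`x = a⁶` lost).  [OURS · L1 w44b · res-D-pv-037 gen 9; AI-written and AI-reviewed only (weaker than
expert review); NOT a statement of the manuscript under study, and no statement of that manuscript is
used.]

**What this file is for.** The crux's `ca` is `⋃ₙ ⋂_{i ≥ n} ann Extⁱ`, so a kernel kill needs
`x ∉ caⁿ(T₁)` for EVERY `n`, i.e. `x • Extⁱ ≠ 0` for infinitely many `i`.  The chain's plan records this
"all-levels" step as a NAMED FACT `hGor` («`T₁` Gorenstein ⇒ `ca(T₁) ⊆ s-ann(L)` for every MCM `L`»,
Esentepe Lemma 2.3), because `W` is a codimension-4 Gorenstein ring with non-periodic resolutions.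
Here the step is PROVED, for the class of rings `T₁` belongs to: `W` is a free FROBENIUS ORDER over the
polynomial ring `P₀ = k[a⁶, b³, c²]` (basis `1, a⁴b, a²b², a³c, abc, a⁵b²c`; Frobenius form `τ` = the
`P₀`-coefficient of `a⁵b²c`, whose Gram matrix is a permutation matrix — res-D-pv-058's U15), and over a
Frobenius order every lattice has an EXPLICIT, uniform cosyzygy ladder.

**Setting (abstract).** `P → Λ` commutative rings (`Algebra P Λ`), a `P`-linear form `τ : Λ → P` and
finite families `b`, `b∨ : ι → Λ` that are DUAL BASES for `τ`:
`∀ y, Σᵢ τ(y·b∨ᵢ) bᵢ = y` and `∀ y, Σᵢ τ(y·bᵢ) b∨ᵢ = y` (hypotheses `h₁`, `h₂`; no `def`).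

* §0 `not_mem_cohomologyAnnihilatorOfDegree_of_forall_isSyzygy` (any noetherian `T`): if `K` is, for
  every `n`, an `n`-th syzygy of some finitely generated module (an «infinite syzygy») and `x` does NOT
  stably annihilate `K`, then `x ∉ caⁿ(T)` for every `n` (and `x ∉ ca(T)`); retract forms.  One line from
  CA1 `mem_cohomologyAnnihilatorOfDegree_succ_iff_forall_isSyzygy` (p497920).
* §1 `casimir` — the Casimir identity `Σᵢ b∨ᵢ ⊗ bᵢy = Σᵢ y b∨ᵢ ⊗ bᵢ` in `Λ ⊗_P Λ`;
  `exists_splitEmbedding` — for every `Λ`-module `L`, the map `Φ ℓ = Σᵢ b∨ᵢ ⊗ bᵢ•ℓ : L → Λ ⊗_P L` is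
  `Λ`-LINEAR (Casimir) and split over `P` by `σ (λ ⊗ ℓ) = τ(λ)•ℓ` (`Σ τ(b∨ᵢ) bᵢ = 1`).
* §2 `exists_cosyzygy` — the LADDER STEP: for `L` finitely generated over `Λ` and PROJECTIVE OVER `P`
  (`Λ` finite projective over `P`), `0 → L → Λ ⊗_P L → L₁ → 0` exhibits `L` as a first syzygy
  (`IsSyzygy 1 L₁ L`) of a module `L₁` that is again finitely generated over `Λ` and projective over `P`
  (`Λ ⊗_P L` is a finitely generated projective `Λ`-module; `L₁` is a `P`-direct summand of it).
* §3 `exists_isSyzygy_of_projective` — induction: such an `L` is an `n`-th syzygy for EVERY `n`.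
* §4 **`not_mem_cohomologyAnnihilatorOfDegree_of_frobeniusOrder`** /
  **`not_mem_cohomologyAnnihilator_of_frobeniusOrder`**: `Λ` noetherian, `L` finitely generated over
  `Λ` and projective over `P`, `¬ StablyAnnihilates Λ x L` ⇒ `x ∉ caⁿ(Λ)` for every `n`, `x ∉ ca(Λ)`;
  contrapositive `stablyAnnihilates_of_mem_cohomologyAnnihilator_of_frobeniusOrder` («`ca(Λ)` stably
  annihilates every lattice» — the Frobenius-order substitute for Esentepe's Lemma 2.3).
* §5 `dualBases_of_basis` — dual bases from two `P`-bases `b`, `b∨` with `τ(bᵢ b∨ⱼ) = δᵢⱼ` (the shape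
  U15 delivers: `b∨` is a reindexing of `b`), and the basis forms `…_of_frobeniusOrder_basis`.

**Use in K5.** `Λ := W` with U15's bases over `P := P₀`, `L := X_b` (projective over `P₀` = the MCM
obligation), base-changed to `T₁ = loc O W` along the flat localisation (sibling file
`…FrobeniusOrderLocal.lean`), `x := a⁶`, `¬ StablyAnnihilates` = K4(c) ⇒ `a⁶ ∉ ca(T₁)` OUTRIGHT — the
kill is conditional on the Esentepe print facts `hE`/`hca` only, not on `hGor`.

References (mechanism only; nothing is cited as a premise): F. Kasch, Math. Ann. 127 (1954) (Frobenius
extensions); D. G. Higman, Canad. J. Math. 7 (1955); S. B. Iyengar, R. Takahashi, IMRN 2016 §2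
[`IyengarTakahashi2014`]; Ö. Esentepe, arXiv:1807.05471 Lemma 2.3 [`Esentepe2018`].
-/

noncomputable section

-- single-problem summit: the doubled namespace component `ResolutionOfSingularities` is forced
set_option linter.dupNamespace false

namespace Summit.ResolutionOfSingularities.ResolutionOfSingularities.Theorems.HomologicalConductor.FrobeniusOrderSyzygy

open CategoryTheory TensorProduct Literature.RingTheory.CohomologyAnnihilator
open Summit.ResolutionOfSingularities.ResolutionOfSingularities.Theorems.NoZeno.SandwichCluster
open Summit.ResolutionOfSingularities.ResolutionOfSingularities.Theorems.HomologicalConductor.CompletionAscentSyzygyRetract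

universe u

/-! ## §0 The generic device: a non-stably-annihilated infinite syzygy lies outside every `caⁿ` -/

section Device

variable {T : Type u} [CommRing T]

/-- If `K` is an `n`-th syzygy of a finitely generated module and `x` does not stably annihilate `K`,
then `x ∉ caⁿ⁺¹(T)` (contrapositive of CA1). [cite: IyengarTakahashi2014, Remark 2.13] -/
theorem not_mem_cohomologyAnnihilatorOfDegree_succ_of_isSyzygy [IsNoetherianRing T] {n : ℕ}
    {x : T} {M K : ModuleCat.{u} T} (hM : Module.Finite T M) (hK : IsSyzygy n M K)
    (hx : ¬ StablyAnnihilates T x K) : x ∉ cohomologyAnnihilatorOfDegree T (n + 1) := fun h =>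
  hx ((mem_cohomologyAnnihilatorOfDegree_succ_iff_forall_isSyzygy x).mp h M K hM hK)

/-- **The infinite-syzygy device, levelled.** If `K` is, for every `n`, an `n`-th syzygy of some
finitely generated `T`-module, and `x` does not stably annihilate `K`, then `x ∉ caⁿ(T)` for every `n`
(`caⁿ ⊆ caⁿ⁺¹` and the previous lemma). [OURS · L1 w44b] -/
theorem not_mem_cohomologyAnnihilatorOfDegree_of_forall_isSyzygy [IsNoetherianRing T] {x : T}
    {K : ModuleCat.{u} T}
    (hK : ∀ n : ℕ, ∃ M : ModuleCat.{u} T, Module.Finite T M ∧ IsSyzygy n M K)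
    (hx : ¬ StablyAnnihilates T x K) (n : ℕ) : x ∉ cohomologyAnnihilatorOfDegree T n := by
  intro h
  obtain ⟨M, hM, hMK⟩ := hK n
  exact not_mem_cohomologyAnnihilatorOfDegree_succ_of_isSyzygy hM hMK hx
    (cohomologyAnnihilatorOfDegree_mono (Nat.le_succ n) h)

/-- **The infinite-syzygy device.** An element that does not stably annihilate an infinite syzygy lies
outside the cohomology annihilator `ca(T) = ⋃ₙ caⁿ(T)`. [OURS · L1 w44b] -/
theorem not_mem_cohomologyAnnihilator_of_forall_isSyzygy [IsNoetherianRing T] {x : T}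
    {K : ModuleCat.{u} T}
    (hK : ∀ n : ℕ, ∃ M : ModuleCat.{u} T, Module.Finite T M ∧ IsSyzygy n M K)
    (hx : ¬ StablyAnnihilates T x K) : x ∉ cohomologyAnnihilator T := by
  rw [mem_cohomologyAnnihilator_iff]
  rintro ⟨n, hn⟩
  exact not_mem_cohomologyAnnihilatorOfDegree_of_forall_isSyzygy hK hx n hn

/-- Retract form, levelled: if `K` is, for every `n`, a RETRACT of an `n`-th syzygy of a finitely
generated module, and `x` does not stably annihilate `K`, then `x ∉ caⁿ(T)` for every `n` (stable
annihilation passes to retracts, `StablyAnnihilates.of_retract`). [OURS · L1 w44b] -/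
theorem not_mem_cohomologyAnnihilatorOfDegree_of_forall_retract_isSyzygy [IsNoetherianRing T]
    {x : T} {K : ModuleCat.{u} T}
    (hK : ∀ n : ℕ, ∃ (M K' : ModuleCat.{u} T), Module.Finite T M ∧ IsSyzygy n M K' ∧
      ∃ (i : K ⟶ K') (p : K' ⟶ K), i ≫ p = 𝟙 K)
    (hx : ¬ StablyAnnihilates T x K) (n : ℕ) : x ∉ cohomologyAnnihilatorOfDegree T n := by
  intro h
  obtain ⟨M, K', hM, hMK', i, p, hip⟩ := hK n
  have h' : StablyAnnihilates T x K' :=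
    (mem_cohomologyAnnihilatorOfDegree_succ_iff_forall_isSyzygy x).mp
      (cohomologyAnnihilatorOfDegree_mono (Nat.le_succ n) h) M K' hM hMK'
  exact hx (StablyAnnihilates.of_retract i p hip h')

/-- Retract form: an element that does not stably annihilate a retract of arbitrarily high syzygies
lies outside `ca(T)`. [OURS · L1 w44b] -/
theorem not_mem_cohomologyAnnihilator_of_forall_retract_isSyzygy [IsNoetherianRing T] {x : T}
    {K : ModuleCat.{u} T}
    (hK : ∀ n : ℕ, ∃ (M K' : ModuleCat.{u} T), Module.Finite T M ∧ IsSyzygy n M K' ∧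
      ∃ (i : K ⟶ K') (p : K' ⟶ K), i ≫ p = 𝟙 K)
    (hx : ¬ StablyAnnihilates T x K) : x ∉ cohomologyAnnihilator T := by
  rw [mem_cohomologyAnnihilator_iff]
  rintro ⟨n, hn⟩
  exact not_mem_cohomologyAnnihilatorOfDegree_of_forall_retract_isSyzygy hK hx n hn

end Device

/-! ## §1 Frobenius orders: dual bases, the Casimir identity, the split embedding `L ↪ Λ ⊗_P L` -/

section Frobenius

variable {P Λ : Type u} [CommRing P] [CommRing Λ] [Algebra P Λ]
variable {ι : Type} [Fintype ι] {τ : Λ →ₗ[P] P} {b bd : ι → Λ}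

/-- **The Casimir identity** of a pair of dual bases `b`, `b∨` for a `P`-linear form `τ` on a
commutative `P`-algebra `Λ` (`Σᵢ τ(y b∨ᵢ) bᵢ = y = Σᵢ τ(y bᵢ) b∨ᵢ` for all `y`): for every `y ∈ Λ`,
`Σᵢ b∨ᵢ ⊗ (bᵢ y) = Σᵢ (y b∨ᵢ) ⊗ bᵢ` in `Λ ⊗_P Λ`. [folklore: Kasch 1954 / Higman 1955] -/
theorem casimir (h₁ : ∀ y : Λ, ∑ i, τ (y * bd i) • b i = y)
    (h₂ : ∀ y : Λ, ∑ i, τ (y * b i) • bd i = y) (y : Λ) :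
    ∑ i, (bd i ⊗ₜ[P] (b i * y) : Λ ⊗[P] Λ) = ∑ i, (y * bd i) ⊗ₜ[P] b i := by
  calc ∑ i, (bd i ⊗ₜ[P] (b i * y) : Λ ⊗[P] Λ)
      = ∑ i, bd i ⊗ₜ[P] (∑ j, τ (b i * y * bd j) • b j) := by
        refine Finset.sum_congr rfl fun i _ => ?_
        rw [h₁]
    _ = ∑ i, ∑ j, τ (b i * y * bd j) • (bd i ⊗ₜ[P] b j) := by
        refine Finset.sum_congr rfl fun i _ => ?_
        rw [tmul_sum]
        refine Finset.sum_congr rfl fun j _ => ?_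
        rw [tmul_smul]
    _ = ∑ j, ∑ i, τ (y * bd j * b i) • (bd i ⊗ₜ[P] b j) := by
        rw [Finset.sum_comm]
        refine Finset.sum_congr rfl fun j _ => Finset.sum_congr rfl fun i _ => ?_
        rw [show b i * y * bd j = y * bd j * b i by ring]
    _ = ∑ j, (∑ i, τ (y * bd j * b i) • bd i) ⊗ₜ[P] b j := by
        refine Finset.sum_congr rfl fun j _ => ?_
        rw [sum_tmul]
        refine Finset.sum_congr rfl fun i _ => ?_
        rw [smul_tmul']
    _ = ∑ j, (y * bd j) ⊗ₜ[P] b j := by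
        refine Finset.sum_congr rfl fun j _ => ?_
        rw [h₂]

/-- `Σᵢ τ(b∨ᵢ) bᵢ = 1` (the dual-basis expansion of `1`). [folklore] -/
theorem sum_smul_eq_one (h₁ : ∀ y : Λ, ∑ i, τ (y * bd i) • b i = y) :
    ∑ i, τ (bd i) • b i = (1 : Λ) := by
  have h := h₁ 1
  simpa only [one_mul] using h

variable (L : Type u) [AddCommGroup L] [Module Λ L] [Module P L] [IsScalarTower P Λ L]

/-- **The split embedding `L ↪ Λ ⊗_P L`.** For every `Λ`-module `L` there are a `Λ`-LINEAR map
`Φ : L → Λ ⊗_P L`, `Φ ℓ = Σᵢ b∨ᵢ ⊗ bᵢ•ℓ` (`Λ` acting on the left factor; linearity is the Casimir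
identity), and a `P`-linear map `σ : Λ ⊗_P L → L`, `σ (λ ⊗ ℓ) = τ(λ)•ℓ`, with `σ ∘ Φ = id`
(`Σᵢ τ(b∨ᵢ) bᵢ = 1`). [folklore: the unit of the Frobenius (co)induction adjunction] -/
theorem exists_splitEmbedding (h₁ : ∀ y : Λ, ∑ i, τ (y * bd i) • b i = y)
    (h₂ : ∀ y : Λ, ∑ i, τ (y * b i) • bd i = y) :
    ∃ (Φ : L →ₗ[Λ] Λ ⊗[P] L) (σ : Λ ⊗[P] L →ₗ[P] L),
      (∀ ℓ : L, Φ ℓ = ∑ i, bd i ⊗ₜ[P] (b i • ℓ)) ∧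
      (∀ (a : Λ) (ℓ : L), σ (a ⊗ₜ[P] ℓ) = τ a • ℓ) ∧ ∀ ℓ : L, σ (Φ ℓ) = ℓ := by
  -- for fixed `ℓ`, the `P`-linear map `Λ ⊗ Λ → Λ ⊗ L`, `u ⊗ v ↦ u ⊗ v•ℓ`
  let θ : L → (Λ ⊗[P] Λ →ₗ[P] Λ ⊗[P] L) := fun ℓ =>
    LinearMap.lTensor Λ ((LinearMap.toSpanSingleton Λ L ℓ).restrictScalars P)
  have hθ : ∀ (ℓ : L) (u v : Λ), θ ℓ (u ⊗ₜ[P] v) = u ⊗ₜ[P] (v • ℓ) := fun ℓ u v => by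
    simp only [θ, LinearMap.lTensor_tmul, LinearMap.restrictScalars_apply,
      LinearMap.toSpanSingleton_apply]
  let Φ : L →ₗ[Λ] Λ ⊗[P] L :=
    { toFun := fun ℓ => ∑ i, bd i ⊗ₜ[P] (b i • ℓ)
      map_add' := fun ℓ ℓ' => by
        simp only [smul_add, tmul_add, Finset.sum_add_distrib]
      map_smul' := fun y ℓ => by
        simp only [RingHom.id_apply]
        calc ∑ i, (bd i ⊗ₜ[P] (b i • y • ℓ) : Λ ⊗[P] L)
            = ∑ i, θ ℓ (bd i ⊗ₜ[P] (b i * y)) := by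
              refine Finset.sum_congr rfl fun i _ => ?_
              rw [hθ, mul_smul]
          _ = θ ℓ (∑ i, bd i ⊗ₜ[P] (b i * y)) := by rw [map_sum]
          _ = θ ℓ (∑ i, (y * bd i) ⊗ₜ[P] b i) := by rw [casimir h₁ h₂ y]
          _ = ∑ i, (y * bd i) ⊗ₜ[P] (b i • ℓ) := by
              rw [map_sum]
              exact Finset.sum_congr rfl fun i _ => hθ ℓ _ _
          _ = y • ∑ i, bd i ⊗ₜ[P] (b i • ℓ) := by
              rw [Finset.smul_sum]
              refine Finset.sum_congr rfl fun i _ => ?_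
              rw [smul_tmul', smul_eq_mul] }
  let σ : Λ ⊗[P] L →ₗ[P] L := TensorProduct.lift ((LinearMap.lsmul P L).comp τ)
  have hσ : ∀ (a : Λ) (ℓ : L), σ (a ⊗ₜ[P] ℓ) = τ a • ℓ := fun a ℓ => by
    simp only [σ, TensorProduct.lift.tmul, LinearMap.coe_comp, Function.comp_apply,
      LinearMap.lsmul_apply]
  refine ⟨Φ, σ, fun ℓ => rfl, hσ, fun ℓ => ?_⟩
  change σ (∑ i, bd i ⊗ₜ[P] (b i • ℓ)) = ℓ
  rw [map_sum]
  calc ∑ i, σ (bd i ⊗ₜ[P] (b i • ℓ)) = ∑ i, (τ (bd i) • b i) • ℓ := by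
        refine Finset.sum_congr rfl fun i _ => ?_
        rw [hσ, smul_assoc]
    _ = (∑ i, τ (bd i) • b i) • ℓ := by rw [Finset.sum_smul]
    _ = ℓ := by rw [sum_smul_eq_one h₁, one_smul]

/-! ## §2 The ladder step: `0 → L → Λ ⊗_P L → L₁ → 0` -/

/-- **The cosyzygy of a lattice over a Frobenius order.** `Λ` finite projective over `P` with dual
bases `b`, `b∨` for `τ`; `L` a finitely generated `Λ`-module that is PROJECTIVE OVER `P`.  Then there is
a `Λ`-module `L₁`, again finitely generated over `Λ` and projective over `P`, of which `L` is a FIRST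
SYZYGY: `0 → L —Φ→ Λ ⊗_P L → L₁ → 0` with `Λ ⊗_P L` finitely generated `Λ`-projective (base change of
the `P`-projective `L`), `L₁ = (Λ ⊗_P L) ⧸ Φ(L)` a `P`-direct summand of `Λ ⊗_P L` (the `P`-splitting
`σ`), hence `P`-projective. [OURS · L1 w44b; mechanism: Frobenius reciprocity, Kasch 1954] -/
theorem exists_cosyzygy [Module.Finite P Λ] [Module.Projective P Λ]
    (h₁ : ∀ y : Λ, ∑ i, τ (y * bd i) • b i = y)
    (h₂ : ∀ y : Λ, ∑ i, τ (y * b i) • bd i = y) [Module.Finite Λ L] [Module.Projective P L] :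
    ∃ (L₁ : Type u) (_ : AddCommGroup L₁) (_ : Module Λ L₁) (_ : Module P L₁)
      (_ : IsScalarTower P Λ L₁), Module.Finite Λ L₁ ∧ Module.Projective P L₁ ∧
        IsSyzygy 1 (ModuleCat.of Λ L₁) (ModuleCat.of Λ L) := by
  obtain ⟨Φ, σ, hΦ, hσ, hσΦ⟩ := exists_splitEmbedding L h₁ h₂
  have hΦinj : Function.Injective Φ := fun ℓ ℓ' h => by
    have := congrArg σ h
    rwa [hσΦ, hσΦ] at this
  -- `L` is finitely generated over `P` (through `Λ`), so `Λ ⊗_P L` is finitely generated over `Λ`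
  haveI : Module.Finite P L := Module.Finite.trans Λ L
  -- the cokernel `L₁ = (Λ ⊗_P L) ⧸ Φ(L)`
  let N : Submodule Λ (Λ ⊗[P] L) := LinearMap.range Φ
  refine ⟨(Λ ⊗[P] L) ⧸ N, inferInstance, inferInstance, inferInstance, inferInstance,
    inferInstance, ?_, ?_⟩
  · -- `L₁` is a `P`-direct summand of the `P`-projective module `Λ ⊗_P L`
    let g : Λ ⊗[P] L →ₗ[P] Λ ⊗[P] L := LinearMap.id - (Φ.restrictScalars P).comp σ
    have hg : N.restrictScalars P ≤ LinearMap.ker g := by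
      rintro m ⟨ℓ, rfl⟩
      simp only [g, LinearMap.mem_ker, LinearMap.sub_apply, LinearMap.id_apply,
        LinearMap.coe_comp, Function.comp_apply, LinearMap.restrictScalars_apply, hσΦ, sub_self]
    let s : ((Λ ⊗[P] L) ⧸ N) →ₗ[P] Λ ⊗[P] L :=
      ((N.restrictScalars P).liftQ g hg).comp (Submodule.Quotient.restrictScalarsEquiv P N).symm.toLinearMap
    let q : Λ ⊗[P] L →ₗ[P] (Λ ⊗[P] L) ⧸ N := N.mkQ.restrictScalars P
    refine Module.Projective.of_split s q ?_
    apply LinearMap.ext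
    intro m
    induction m using Submodule.Quotient.induction_on with
    | H m =>
      simp only [s, q, g, LinearMap.coe_comp, Function.comp_apply, LinearEquiv.coe_toLinearMap,
        Submodule.Quotient.restrictScalarsEquiv_symm_mk, Submodule.liftQ_apply,
        LinearMap.sub_apply, LinearMap.id_apply, LinearMap.restrictScalars_apply, map_sub,
        Submodule.mkQ_apply]
      rw [sub_eq_self, Submodule.Quotient.mk_eq_zero]
      exact LinearMap.mem_range_self Φ _
  · -- `0 → L → Λ ⊗_P L → L₁ → 0` with finitely generated projective middle
    rw [isSyzygy_one_iff]
    refine ⟨ModuleCat.of Λ (Λ ⊗[P] L), inferInstance,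
      (IsProjective.iff_projective (R := Λ) (Λ ⊗[P] L)).mp inferInstance, ?_⟩
    obtain ⟨w, hS⟩ := exists_shortExact_of_linearMap (Y := ModuleCat.of Λ L)
      (M := ModuleCat.of Λ (Λ ⊗[P] L)) (X := ModuleCat.of Λ ((Λ ⊗[P] L) ⧸ N)) Φ N.mkQ hΦinj
      (Submodule.mkQ_surjective N) (LinearMap.exact_map_mkQ_range Φ)
    exact ⟨_, _, w, hS⟩

/-! ## §3 Lattices over a Frobenius order are infinite syzygies -/

/-- **Every lattice over a Frobenius order is an `n`-th syzygy for every `n`.** `Λ` finite projective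
over `P` with dual bases `b`, `b∨` for `τ`; then every finitely generated `Λ`-module that is projective
over `P` is, for every `n`, an `n`-th syzygy (in the tree's sense `IsSyzygy`, chains of short exact
sequences with finitely generated projective middles) of some finitely generated `Λ`-module (again a
lattice) — by induction on `n` along the cosyzygy ladder `exists_cosyzygy`.
[OURS · L1 w44b; mechanism: Kasch 1954 / Higman 1955] -/
theorem exists_isSyzygy_of_projective [Module.Finite P Λ] [Module.Projective P Λ]
    (h₁ : ∀ y : Λ, ∑ i, τ (y * bd i) • b i = y) (h₂ : ∀ y : Λ, ∑ i, τ (y * b i) • bd i = y) :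
    ∀ (n : ℕ) (L : Type u) [AddCommGroup L] [Module Λ L] [Module P L] [IsScalarTower P Λ L]
      [Module.Finite Λ L] [Module.Projective P L],
      ∃ M : ModuleCat.{u} Λ, Module.Finite Λ M ∧ IsSyzygy n M (ModuleCat.of Λ L)
  | 0, L, _, _, _, _, _, _ => ⟨ModuleCat.of Λ L, inferInstance, ⟨Iso.refl _⟩⟩
  | n + 1, L, _, _, _, _, _, _ => by
    obtain ⟨L₁, _, _, _, _, hfin, hproj, h1⟩ := exists_cosyzygy (τ := τ) (b := b) (bd := bd) L h₁ h₂
    haveI := hfin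
    haveI := hproj
    obtain ⟨M, hM, hn⟩ := exists_isSyzygy_of_projective h₁ h₂ n L₁
    refine ⟨M, hM, ?_⟩
    have := hn.trans h1
    rwa [Nat.add_comm] at this

/-! ## §4 The all-levels device for Frobenius orders -/

/-- **Not stably annihilated on a lattice ⇒ outside `caⁿ(Λ)` for EVERY `n` (Frobenius orders).**
`P → Λ` commutative rings, `Λ` noetherian and finite projective over `P`, carrying dual bases `b`, `b∨`
for a `P`-linear form `τ : Λ → P`; `L` a finitely generated `Λ`-module that is projective over `P`;
if `x • 𝟙 L` does NOT factor through a finitely generated projective `Λ`-module, then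
`x ∉ caⁿ(Λ)` for every `n` — `L` is an infinite syzygy (§3) and CA1.  The K-C3 instance: `Λ = T₁`
(a Frobenius order over `(k[a⁶,b³,c²])_𝔫` via U15's dual bases), `L = X_b ⊗ T₁`, `x = a⁶`.
[OURS · L1 w44b] -/
theorem not_mem_cohomologyAnnihilatorOfDegree_of_frobeniusOrder [IsNoetherianRing Λ]
    [Module.Finite P Λ] [Module.Projective P Λ]
    (h₁ : ∀ y : Λ, ∑ i, τ (y * bd i) • b i = y) (h₂ : ∀ y : Λ, ∑ i, τ (y * b i) • bd i = y)
    [Module.Finite Λ L] [Module.Projective P L] {x : Λ}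
    (hx : ¬ StablyAnnihilates Λ x (ModuleCat.of Λ L)) (n : ℕ) :
    x ∉ cohomologyAnnihilatorOfDegree Λ n :=
  not_mem_cohomologyAnnihilatorOfDegree_of_forall_isSyzygy
    (fun m => exists_isSyzygy_of_projective h₁ h₂ m L) hx n

/-- **Not stably annihilated on a lattice ⇒ outside `ca(Λ)` (Frobenius orders)** — the `ca(Λ) = ⋃ₙ caⁿ(Λ)`
form of the previous theorem; this is the statement the K5 assembly consumes in place of the named fact
`hGor` («Gorenstein ⇒ `ca ⊆ s-ann(MCM)`»). [OURS · L1 w44b] -/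
theorem not_mem_cohomologyAnnihilator_of_frobeniusOrder [IsNoetherianRing Λ]
    [Module.Finite P Λ] [Module.Projective P Λ]
    (h₁ : ∀ y : Λ, ∑ i, τ (y * bd i) • b i = y) (h₂ : ∀ y : Λ, ∑ i, τ (y * b i) • bd i = y)
    [Module.Finite Λ L] [Module.Projective P L] {x : Λ}
    (hx : ¬ StablyAnnihilates Λ x (ModuleCat.of Λ L)) : x ∉ cohomologyAnnihilator Λ :=
  not_mem_cohomologyAnnihilator_of_forall_isSyzygy
    (fun m => exists_isSyzygy_of_projective h₁ h₂ m L) hx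

/-- The contrapositive, as the chain will quote it: over a noetherian Frobenius order, an element of
`ca(Λ)` stably annihilates EVERY lattice (finitely generated `Λ`-module projective over `P`) — the
Frobenius-order substitute for «Gorenstein ⇒ `ca(R) ⊆ ⋂_{L MCM} s-ann(L)`» (Esentepe Lemma 2.3).
[OURS · L1 w44b] -/
theorem stablyAnnihilates_of_mem_cohomologyAnnihilator_of_frobeniusOrder [IsNoetherianRing Λ]
    [Module.Finite P Λ] [Module.Projective P Λ]
    (h₁ : ∀ y : Λ, ∑ i, τ (y * bd i) • b i = y) (h₂ : ∀ y : Λ, ∑ i, τ (y * b i) • bd i = y)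
    [Module.Finite Λ L] [Module.Projective P L] {x : Λ} (hx : x ∈ cohomologyAnnihilator Λ) :
    StablyAnnihilates Λ x (ModuleCat.of Λ L) := by
  by_contra h
  exact not_mem_cohomologyAnnihilator_of_frobeniusOrder L h₁ h₂ h hx

/-! ## §5 Dual bases from a basis with unimodular Gram matrix (the form U15 delivers) -/

/-- **Dual bases from two `P`-bases with Gram matrix `1`.** If `b` and `b∨` are `P`-bases of `Λ` with
`τ(bᵢ b∨ⱼ) = δᵢⱼ`, then `(b, b∨)` are dual bases for `τ` in the sense of `h₁`, `h₂`.  (For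
`W = k[a,b,c]^{μ₆(1,2,3)}` over `P₀ = k[a⁶,b³,c²]`: `b = (1, a⁴b, a²b², a³c, abc, a⁵b²c)`, `τ` = the
coefficient of `a⁵b²c`, `b∨ = (a⁵b²c, abc, a³c, a²b², a⁴b, 1)` — a reindexing of `b`; res-D-pv-058 U15.)
[folklore] -/
theorem dualBases_of_basis [DecidableEq ι] (β βd : Module.Basis ι P Λ)
    (hG : ∀ i j, τ (β i * βd j) = if i = j then 1 else 0) :
    (∀ y : Λ, ∑ i, τ (y * βd i) • β i = y) ∧ (∀ y : Λ, ∑ i, τ (y * β i) • βd i = y) := by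
  have hcoord : ∀ (γ γd : Module.Basis ι P Λ), (∀ i j, τ (γ i * γd j) = if i = j then 1 else 0) →
      ∀ (y : Λ) (i : ι), τ (y * γd i) = γ.repr y i := by
    intro γ γd hγ y i
    conv_lhs => rw [← γ.sum_repr y]
    rw [Finset.sum_mul, map_sum]
    simp only [smul_mul_assoc, map_smul, hγ, smul_eq_mul, mul_ite, mul_one, mul_zero,
      Finset.sum_ite_eq', Finset.mem_univ, if_true]
  have hG' : ∀ i j, τ (βd i * β j) = if i = j then 1 else 0 := fun i j => by
    rw [mul_comm, hG j i]
    by_cases h : i = j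
    · subst h; rfl
    · rw [if_neg (Ne.symm h), if_neg h]
  refine ⟨fun y => ?_, fun y => ?_⟩
  · conv_rhs => rw [← β.sum_repr y]
    exact Finset.sum_congr rfl fun i _ => by rw [hcoord β βd hG y i]
  · conv_rhs => rw [← βd.sum_repr y]
    exact Finset.sum_congr rfl fun i _ => by rw [hcoord βd β hG' y i]

/-- **The all-levels device, basis form** (the shape in which U15 delivers the Frobenius structure of
`W` over `k[a⁶,b³,c²]`): `Λ` noetherian with two `P`-bases `b`, `b∨` and a `P`-linear form `τ` with
`τ(bᵢ b∨ⱼ) = δᵢⱼ`; `L` finitely generated over `Λ` and projective over `P`; then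
`¬ StablyAnnihilates Λ x L → x ∉ caⁿ(Λ)` for every `n`. [OURS · L1 w44b] -/
theorem not_mem_cohomologyAnnihilatorOfDegree_of_frobeniusOrder_basis [IsNoetherianRing Λ]
    [DecidableEq ι] (β βd : Module.Basis ι P Λ) (hG : ∀ i j, τ (β i * βd j) = if i = j then 1 else 0)
    [Module.Finite Λ L] [Module.Projective P L] {x : Λ}
    (hx : ¬ StablyAnnihilates Λ x (ModuleCat.of Λ L)) (n : ℕ) :
    x ∉ cohomologyAnnihilatorOfDegree Λ n := by
  haveI : Module.Finite P Λ := Module.Finite.of_basis β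
  haveI : Module.Projective P Λ := Module.Projective.of_basis β
  obtain ⟨h₁, h₂⟩ := dualBases_of_basis (τ := τ) β βd hG
  exact not_mem_cohomologyAnnihilatorOfDegree_of_frobeniusOrder L h₁ h₂ hx n

/-- **The all-levels device, basis form, for `ca(Λ)`**: under the hypotheses of the previous theorem,
`¬ StablyAnnihilates Λ x L → x ∉ ca(Λ)`. [OURS · L1 w44b] -/
theorem not_mem_cohomologyAnnihilator_of_frobeniusOrder_basis [IsNoetherianRing Λ]
    [DecidableEq ι] (β βd : Module.Basis ι P Λ) (hG : ∀ i j, τ (β i * βd j) = if i = j then 1 else 0)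
    [Module.Finite Λ L] [Module.Projective P L] {x : Λ}
    (hx : ¬ StablyAnnihilates Λ x (ModuleCat.of Λ L)) : x ∉ cohomologyAnnihilator Λ := by
  rw [mem_cohomologyAnnihilator_iff]
  rintro ⟨n, hn⟩
  exact not_mem_cohomologyAnnihilatorOfDegree_of_frobeniusOrder_basis L β βd hG hx n hn

end Frobenius

end Summit.ResolutionOfSingularities.ResolutionOfSingularities.Theorems.HomologicalConductor.FrobeniusOrderSyzygy

end
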